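import Summits.CriticalPhenomena.PercolationContinuityZ3.Theorems.Transplant.FKDoubleFanSetLevel
import Summits.CriticalPhenomena.PercolationContinuityZ3.Theorems.Transplant.FKDoubleFanOneSidedFinal
import Summits.CriticalPhenomena.PercolationContinuityZ3.Theorems.Transplant.FKDoubleFanCrossFar
import HarnessLib

/-!
# Double fans `K₂ ∨ P_{m+1}`: the far cross-apex pair for a FIXED middle pattern reduces to 36 polynomial CELL inequalities

Helper file (`--supports stmt-CriticalPhenomena-4575`), FK sub-lane `prim-bschramm-fk-3` (gen 48); builds on p205010 (kernel theorem, internal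
audit signed; external expert review pending).  Pure real algebra plus one measure-level corollary; no named facts, no sorries; standard axioms.
Memo `bschramm/prim-bschramm-fk-3/FAR-CROSS-XXIII.md` §1.

For the cross-apex pair `(a c_j, b c_{j+d+1})` of a weighted double fan the Rayleigh difference of the four pinned partition functions is
(`…CrossFar`, `…Wedge`) `q²·⟪∧²E_{r_d}·∧²(blocks)·(u ∧ P_a u), s ∧ P_b s⟫`.  This file makes the dependence on the prefix `u` and the reversed
suffix `s` EXPLICIT and LINEAR: the input bivector `u ∧ P_a u` is **`inputBiv (uprods u)`** and the target `s ∧ P_b s` is **`targetBiv (sprods s)`**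
(six hat products each, `…OneSidedProducts`), the blocks act through the whole-letter operators of `…LetterCone` (linearity: `…SetLevel`, `…OneSidedConeSDeg`) (**`opBlocks`**, **`opBlocks_wedgeH`**),
so the Rayleigh difference is `q²·cellFn q mids rd (uprods u) (sprods s)` (**`crossFarZ_rayleigh_eq_cellFn`**) with **`cellFn`** BILINEAR in the two
product vectors.  By the generic ray decomposition `nonneg_of_rays_gen` (`…OneSidedRays`: every leg with non-negative masses and `(U_b)` is, along an
affine fibre, a convex combination of degenerate / floor / roof frame points, whose product vectors lie in the endpoint cone `InEndCone` of
`…OneSidedFinal`) applied to the `u`-leg and — through `sprods = uprods ∘ swapAB` — to the `s`-leg, non-negativity of the Rayleigh difference on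
`InKE × InKE` follows from the **36 CELL INEQUALITIES** **`CellsOK q mids rd`**: `0 ≤ cellFn q mids rd P S` for `P, S` among the endpoint product
vectors `IsEndP` (rays `A, D, AC, BD, 𝟙` and the roof vectors `roofP q t w`) — **`crossFarZ_rayleigh_nonneg_of_wordCells`** (`0 < q ≤ 1`; at `q = 1`
the pairing vanishes).  Measure level (**`negCorr_spokes_cross_far_of_wordCells`**): if the cells of the fan's own middle blocks `midBlocks w a b c j d`
and last rim weight hold for `q < 1`, then `φ(J_{a c_j} ∩ J_{b c_{j+d+1}}) ≤ φ(J_{a c_j})·φ(J_{b c_{j+d+1}})`.  Each cell is an explicit polynomial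
inequality in `q`, the `3d+1` middle weights and at most four roof parameters — the interface for certificate campaigns on fixed patterns
(distance 3: the words `E A E B E` and `E AB E AB E`, memo §2).
[cite: Grimmett2006, §3.9 eq. (3.94) (pp. 63–64)] [folklore]
-/

noncomputable section

namespace Summit.CriticalPhenomena.PercolationContinuityZ3.Theorems

namespace FK

namespace ThreeApex

/-! ### Input and target bivectors as linear functions of the product vectors -/

/-- The input bivector `u ∧ P_a u` as a function of `P = uprods u`. [folklore] -/
def inputBiv (P : P6) : Biv := ⟨0, P.uy, 0, P.uv, P.xy, 0, P.xv, -P.yz, 0, P.zv⟩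

/-- The target bivector `s ∧ P_b s` as a function of `S = sprods s`. [folklore] -/
def targetBiv (S : P6) : Biv := ⟨0, 0, S.uy, S.uv, 0, S.xy, S.xv, S.yz, S.zv, 0⟩

/-- `(AC_0 u) ∧ (AC_1 u) = inputBiv (uprods u)`. [folklore] -/
theorem wedgeH_input_eq (u : V5) : wedgeH (conv (edgeAC 0) u) (conv (edgeAC 1) u) = inputBiv (uprods u) := by
  ext <;> simp only [wedgeH, inputBiv, uprods, conv, edgeAC, hx, hy, hz, V5.total] <;> ring

/-- `(s ∗ BC_0) ∧ (s ∗ BC_1) = targetBiv (sprods s)`. [folklore] -/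
theorem wedgeH_target_eq (s : V5) : wedgeH (conv s (edgeBC 0)) (conv s (edgeBC 1)) = targetBiv (sprods s) := by
  ext <;> simp only [wedgeH, targetBiv, sprods, conv, edgeBC, hx, hy, hz, V5.total] <;> ring

/-- `inputBiv` is additive. [folklore] -/
theorem inputBiv_add (P Q : P6) : inputBiv (P6.add P Q) = Biv.add (inputBiv P) (inputBiv Q) := by
  ext <;> simp only [inputBiv, P6.add, Biv.add] <;> ring

/-- `inputBiv` is homogeneous. [folklore] -/
theorem inputBiv_smul (c : ℝ) (P : P6) : inputBiv (P6.smul c P) = Biv.smul c (inputBiv P) := by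
  ext <;> simp only [inputBiv, P6.smul, Biv.smul] <;> ring

/-! ### Linearity of the whole-letter operators -/

/-- `∧²E_r` is additive. [folklore] -/
theorem opE_add_biv (q r : ℝ) (β γ : Biv) : opE q r (Biv.add β γ) = Biv.add (opE q r β) (opE q r γ) := by
  ext <;> simp only [opE, opTD, opWD, formD, Biv.lin3, Biv.add, Biv.smul] <;> ring

/-- `∧²AC_x` is additive. [folklore] -/
theorem opAC_add_biv (x : ℝ) (β γ : Biv) : opAC x (Biv.add β γ) = Biv.add (opAC x β) (opAC x γ) := by
  ext <;> simp only [opAC, opTa, opWa, Biv.lin3, Biv.add, Biv.smul] <;> ring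

/-- `∧²BC_y` is additive. [folklore] -/
theorem opBC_add_biv (y : ℝ) (β γ : Biv) : opBC y (Biv.add β γ) = Biv.add (opBC y β) (opBC y γ) := by
  ext <;> simp only [opBC, opTb, opWb, Biv.lin3, Biv.add, Biv.smul] <;> ring

/-! ### The block operator of a middle word -/

/-- **The middle blocks on bivectors**: block `(r, x, y)` acts as `∧²AC_x ∘ ∧²BC_y ∘ ∧²E_r`, in the order of `midWord`. [folklore] -/
def opBlocks (q : ℝ) : List (ℝ × ℝ × ℝ) → Biv → Biv
  | [], β => β
  | blk :: rest, β => opBlocks q rest (opAC blk.2.1 (opBC blk.2.2 (opE q blk.1 β)))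

/-- `opBlocks` is `∧²(midWord)`: `opBlocks q mids (X ∧ Y) = midWord X ∧ midWord Y`. [folklore] -/
theorem opBlocks_wedgeH (q : ℝ) : ∀ (mids : List (ℝ × ℝ × ℝ)) (X Y : V5),
    opBlocks q mids (wedgeH X Y) = wedgeH (midWord q mids X) (midWord q mids Y)
  | [], X, Y => rfl
  | blk :: rest, X, Y => by
    simp only [opBlocks, midWord, opE_wedgeH, opBC_wedgeH, opAC_wedgeH]
    exact opBlocks_wedgeH q rest _ _

/-- `opBlocks` is additive. [folklore] -/
theorem opBlocks_add (q : ℝ) : ∀ (mids : List (ℝ × ℝ × ℝ)) (β γ : Biv),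
    opBlocks q mids (Biv.add β γ) = Biv.add (opBlocks q mids β) (opBlocks q mids γ)
  | [], β, γ => rfl
  | blk :: rest, β, γ => by
    simp only [opBlocks, opE_add_biv, opBC_add_biv, opAC_add_biv]
    exact opBlocks_add q rest _ _

/-- `opBlocks` is homogeneous. [folklore] -/
theorem opBlocks_smul (q : ℝ) : ∀ (mids : List (ℝ × ℝ × ℝ)) (c : ℝ) (β : Biv),
    opBlocks q mids (Biv.smul c β) = Biv.smul c (opBlocks q mids β)
  | [], c, β => rfl
  | blk :: rest, c, β => by
    simp only [opBlocks, opE_smul, opBC_smul', opAC_smul]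
    exact opBlocks_smul q rest _ _

/-! ### The cell function -/

/-- **The cell function of a middle pattern**: `cellFn q mids rd P S = ⟪∧²E_{rd}·∧²(blocks)·inputBiv P, targetBiv S⟫` — the Rayleigh
difference divided by `q²`, as a BILINEAR function of the two product vectors. [folklore] -/
def cellFn (q : ℝ) (mids : List (ℝ × ℝ × ℝ)) (rd : ℝ) (P S : P6) : ℝ :=
  pairH q (opE q rd (opBlocks q mids (inputBiv P))) (targetBiv S)

/-- At `q = 1` every cell vanishes (the pairing is identically zero). [folklore] -/
theorem cellFn_q_one (mids : List (ℝ × ℝ × ℝ)) (rd : ℝ) (P S : P6) : cellFn 1 mids rd P S = 0 := by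
  simp only [cellFn, pairH]; ring

/-- Additivity in `P`. [folklore] -/
theorem cellFn_add_left (q : ℝ) (mids : List (ℝ × ℝ × ℝ)) (rd : ℝ) (P Q S : P6) :
    cellFn q mids rd (P6.add P Q) S = cellFn q mids rd P S + cellFn q mids rd Q S := by
  simp only [cellFn, inputBiv_add, opBlocks_add, opE_add_biv, pairH_add_left]

/-- Homogeneity in `P`. [folklore] -/
theorem cellFn_smul_left (q : ℝ) (mids : List (ℝ × ℝ × ℝ)) (rd c : ℝ) (P S : P6) :
    cellFn q mids rd (P6.smul c P) S = c * cellFn q mids rd P S := by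
  simp only [cellFn, inputBiv_smul, opBlocks_smul, opE_smul, pairH_smul_left]

/-- Additivity in `S`. [folklore] -/
theorem cellFn_add_right (q : ℝ) (mids : List (ℝ × ℝ × ℝ)) (rd : ℝ) (P S T : P6) :
    cellFn q mids rd P (P6.add S T) = cellFn q mids rd P S + cellFn q mids rd P T := by
  simp only [cellFn, pairH, targetBiv, P6.add]; ring

/-- Homogeneity in `S`. [folklore] -/
theorem cellFn_smul_right (q : ℝ) (mids : List (ℝ × ℝ × ℝ)) (rd c : ℝ) (P S : P6) :
    cellFn q mids rd P (P6.smul c S) = c * cellFn q mids rd P S := by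
  simp only [cellFn, pairH, targetBiv, P6.smul]; ring

/-- **The Rayleigh difference of the far cross-apex pair is `q²·cellFn` at the product vectors of prefix and suffix.** [folklore] -/
theorem crossFarZ_rayleigh_eq_cellFn (q : ℝ) (mids : List (ℝ × ℝ × ℝ)) (rd : ℝ) (u s : V5) :
    crossFarZ q mids rd u s 1 0 * crossFarZ q mids rd u s 0 1 - crossFarZ q mids rd u s 1 1 * crossFarZ q mids rd u s 0 0 =
      q ^ 2 * cellFn q mids rd (uprods u) (sprods s) := by
  have e : ∀ (τ : ℝ) (X : V5), conv s (conv (edgeBC τ) X) = conv X (conv s (edgeBC τ)) := by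
    intro τ X; simp only [← mul_def]; ac_rfl
  simp only [crossFarZ, e]
  rw [rayleigh_eq_pairH, ← opE_wedgeH, ← opBlocks_wedgeH, wedgeH_input_eq, wedgeH_target_eq]
  rfl

/-! ### The 36 cells and the cone extension -/

/-- **The cell condition of a middle pattern**: `cellFn ≥ 0` at every pair of endpoint product vectors (`IsEndP`: the rays `A, D, AC, BD, 𝟙`
and the roof vectors `roofP q t w`, `t ≥ 0`, `w ∈ [0,1]`) — 36 polynomial inequalities. [folklore] -/
def CellsOK (q : ℝ) (mids : List (ℝ × ℝ × ℝ)) (rd : ℝ) : Prop :=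
  ∀ P S : P6, IsEndP q P → IsEndP q S → 0 ≤ cellFn q mids rd P S

section Cone

variable {q : ℝ} {mids : List (ℝ × ℝ × ℝ)} {rd : ℝ}

/-- Cells against a cone element on the right. [folklore] -/
theorem cellFn_nonneg_endP_cone (H : CellsOK q mids rd) {P S : P6} (hP : IsEndP q P) (hS : InEndCone q S) :
    0 ≤ cellFn q mids rd P S := by
  obtain ⟨cA, cAC, cD, cBD, c1, cR, t, w, hA, hAC, hD, hBD, h1, hR, ht, hw0, hw1, rfl⟩ := hS
  have g := fun (T : P6) (hT : IsEndP q T) => H P T hP hT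
  simp only [cellFn_add_right, cellFn_smul_right]
  have e1 := g rayA (Or.inl rfl)
  have e2 := g rayAC (Or.inr (Or.inr (Or.inl rfl)))
  have e3 := g rayD (Or.inr (Or.inl rfl))
  have e4 := g rayBD (Or.inr (Or.inr (Or.inr (Or.inl rfl))))
  have e5 := g rayOne (Or.inr (Or.inr (Or.inr (Or.inr (Or.inl rfl)))))
  have e6 := g (roofP q t w) (Or.inr (Or.inr (Or.inr (Or.inr (Or.inr ⟨t, w, ht, hw0, hw1, rfl⟩)))))
  have := mul_nonneg hA e1; have := mul_nonneg hAC e2; have := mul_nonneg hD e3; have := mul_nonneg hBD e4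
  have := mul_nonneg h1 e5; have := mul_nonneg hR e6
  linarith

/-- **Cone extension**: the 36 cells give `cellFn ≥ 0` on `InEndCone × InEndCone`. [folklore] -/
theorem cellFn_nonneg_of_cone (H : CellsOK q mids rd) {P S : P6} (hP : InEndCone q P) (hS : InEndCone q S) :
    0 ≤ cellFn q mids rd P S := by
  obtain ⟨cA, cAC, cD, cBD, c1, cR, t, w, hA, hAC, hD, hBD, h1, hR, ht, hw0, hw1, rfl⟩ := hP
  have g := fun (T : P6) (hT : IsEndP q T) => cellFn_nonneg_endP_cone H hT hS
  simp only [cellFn_add_left, cellFn_smul_left]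
  have e1 := g rayA (Or.inl rfl)
  have e2 := g rayAC (Or.inr (Or.inr (Or.inl rfl)))
  have e3 := g rayD (Or.inr (Or.inl rfl))
  have e4 := g rayBD (Or.inr (Or.inr (Or.inr (Or.inl rfl))))
  have e5 := g rayOne (Or.inr (Or.inr (Or.inr (Or.inr (Or.inl rfl)))))
  have e6 := g (roofP q t w) (Or.inr (Or.inr (Or.inr (Or.inr (Or.inr ⟨t, w, ht, hw0, hw1, rfl⟩)))))
  have := mul_nonneg hA e1; have := mul_nonneg hAC e2; have := mul_nonneg hD e3; have := mul_nonneg hBD e4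
  have := mul_nonneg h1 e5; have := mul_nonneg hR e6
  linarith

end Cone

/-! ### The two legs -/

/-- The product vector is affine along the fibre coordinate `u₀` of the apex-`b` frame. [folklore] -/
theorem uprods_vecB_fibre (q W y X Z a b c : ℝ) :
    uprods (vecB q W y X Z (c * a + (1 - c) * b)) =
      P6.add (P6.smul c (uprods (vecB q W y X Z a))) (P6.smul (1 - c) (uprods (vecB q W y X Z b))) := by
  ext <;> simp only [uprods, vecB, P6.add, P6.smul, hx, hy, hz, V5.total] <;> ring

section Legs

variable {q : ℝ} {mids : List (ℝ × ℝ × ℝ)} {rd : ℝ}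

/-- **Leg `s`**: against a cone element `P`, `cellFn q mids rd P (sprods s) ≥ 0` for every `s` with masses `≥ 0` and `(U_a)` (`0 < q < 1`). [folklore] -/
theorem cellFn_nonneg_legS (hq0 : 0 < q) (hq1 : q < 1) (H : CellsOK q mids rd) {P : P6} (hP : InEndCone q P) {s : V5}
    (hs : s.Nonneg) (hU : UCond q s) : 0 ≤ cellFn q mids rd P (sprods s) := by
  have hv : (swapAB s).Nonneg := by obtain ⟨h0, h1, h2, h3, h4⟩ := hs; exact ⟨h0, h1, h3, h2, h4⟩
  have hU' : UCond q (swapAB (swapAB s)) := by rwa [swapAB_swapAB]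
  rw [sprods_eq]
  refine nonneg_of_rays_gen hq0 hq1 (Φ := fun v => cellFn q mids rd P (uprods v)) ?_ ?_ ?_ ?_ hv hU'
  · intro W y X Z a b c
    simp only [uprods_vecB_fibre, cellFn_add_right, cellFn_smul_right]
  · intro y u0 hu0 hyu; exact cellFn_nonneg_of_cone H hP (inEndCone_deg q hu0 hyu)
  · intro W y X Z hX hZ hy hW _; exact cellFn_nonneg_of_cone H hP (inEndCone_floor q hX hZ hy hW)
  · intro κ l t w hκ hl ht hw0 hw1; exact cellFn_nonneg_of_cone H hP (inEndCone_roof q hκ hl ht hw0 hw1)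

/-- **Both legs**: `cellFn q mids rd (uprods u) (sprods s) ≥ 0` for all `u, s` with masses `≥ 0`, `(U_b)(u)`, `(U_a)(s)` (`0 < q < 1`). [folklore] -/
theorem cellFn_nonneg_legs (hq0 : 0 < q) (hq1 : q < 1) (H : CellsOK q mids rd) {u s : V5} (hu : u.Nonneg)
    (huU : UCond q (swapAB u)) (hs : s.Nonneg) (hsU : UCond q s) : 0 ≤ cellFn q mids rd (uprods u) (sprods s) := by
  refine nonneg_of_rays_gen hq0 hq1 (Φ := fun v => cellFn q mids rd (uprods v) (sprods s)) ?_ ?_ ?_ ?_ hu huU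
  · intro W y X Z a b c
    simp only [uprods_vecB_fibre, cellFn_add_left, cellFn_smul_left]
  · intro y u0 hu0 hyu; exact cellFn_nonneg_legS hq0 hq1 H (inEndCone_deg q hu0 hyu) hs hsU
  · intro W y X Z hX hZ hy hW _; exact cellFn_nonneg_legS hq0 hq1 H (inEndCone_floor q hX hZ hy hW) hs hsU
  · intro κ l t w hκ hl ht hw0 hw1; exact cellFn_nonneg_legS hq0 hq1 H (inEndCone_roof q hκ hl ht hw0 hw1) hs hsU

/-- **THE REDUCTION on `InKE × InKE`, all `0 < q ≤ 1`**: the 36 cells of the middle pattern (needed only for `q < 1`) give the Rayleigh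
inequality `Z¹¹Z⁰⁰ ≤ Z¹⁰Z⁰¹` of the far cross-apex pair for every prefix `u` and reversed suffix `s` in `InKE q`. [folklore] -/
theorem crossFarZ_rayleigh_nonneg_of_wordCells (hq0 : 0 < q) (hq1 : q ≤ 1) (H : q < 1 → CellsOK q mids rd) {u s : V5}
    (hu : InKE q u) (hs : InKE q s) :
    0 ≤ crossFarZ q mids rd u s 1 0 * crossFarZ q mids rd u s 0 1 - crossFarZ q mids rd u s 1 1 * crossFarZ q mids rd u s 0 0 := by
  rw [crossFarZ_rayleigh_eq_cellFn]
  rcases eq_or_lt_of_le hq1 with h1 | h1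
  · subst h1; rw [cellFn_q_one]; simp
  · exact mul_nonneg (sq_nonneg q) (cellFn_nonneg_legs hq0 h1 (H h1) (hu.valid hq0.le hq1).nonneg (hu.uCondB hq0 hq1)
      (hs.valid hq0.le hq1).nonneg (hs.uCond hq0 hq1))

end Legs

/-! ### Measure level -/

open MeasureTheory Literature.Probability.LatticeModels Literature.Probability.Percolation
open scoped Classical

variable {V : Type*} [Fintype V]
variable {a b : V} {c : ℕ → V} {m : ℕ}
variable (hab : a ≠ b) (hinj : ∀ j k, j ≤ m → k ≤ m → c j = c k → j = k) (hca : ∀ j, j ≤ m → c j ≠ a) (hcb : ∀ j, j ≤ m → c j ≠ b)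
include hab hinj hca hcb

/-- **Far cross-apex negative correlation from the cells of the fan's own middle.**  For a weighted double fan (`card V = m + 3`, weights
supported on the double-fan pairs), `0 < q ≤ 1`, and `j + d + 1 ≤ m`: if (for `q < 1`) the 36 cells of the middle blocks
`midBlocks w a b c j d` with last rim weight `w(c_{j+d} c_{j+d+1})` hold, then `φ(J_{a c_j} ∩ J_{b c_{j+d+1}}) ≤ φ(J_{a c_j})·φ(J_{b c_{j+d+1}})`.
[cite: Grimmett2006, §3.9 eq. (3.94) (pp. 63–64)] -/
theorem negCorr_spokes_cross_far_of_wordCells (hcard : Fintype.card V = m + 3) {q : ℝ} (hq0 : 0 < q) (hq1 : q ≤ 1)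
    (w : Sym2 V → unitInterval) (hsupp : ∀ e, e ∉ dfPairs a b c m → w e = 0) {j d : ℕ} (hjd : j + d + 1 ≤ m)
    (H : q < 1 → CellsOK q (midBlocks w a b c j d) (wR w s(c (j + d), c (j + d + 1)))) :
    (rcMeasureW w q ∅).real ({ω : BondConfig V | s(a, c j) ∈ ω} ∩ {ω | s(b, c (j + d + 1)) ∈ ω}) ≤
      (rcMeasureW w q ∅).real {ω : BondConfig V | s(a, c j) ∈ ω} *
        (rcMeasureW w q ∅).real {ω : BondConfig V | s(b, c (j + d + 1)) ∈ ω} := by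
  refine negCorr_spokes_cross_far_of_rayleigh hab hinj hca hcb hcard hq0 w hsupp hjd ?_
  have huK : InKE q (conv (edgeBC (wR w s(b, c j))) (blockIn q w a b c j)) :=
    InKE.step (IsLetter.bc (w _).2.1 (w _).2.2) (inKE_blockIn q w a b c j)
  have hsK : InKE q (conv (restVec q w a b c (j + d + 1) (m - (j + d + 1))) (edgeAC (wR w s(a, c (j + d + 1))))) :=
    InKE.mul (inKE_restVec q w a b c (m - (j + d + 1)) (j + d + 1)) (by
      rw [← mul_one (edgeAC (wR w s(a, c (j + d + 1)))), mul_def, one_def]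
      exact InKE.step (IsLetter.ac (w _).2.1 (w _).2.2) InKE.base)
  have key := crossFarZ_rayleigh_nonneg_of_wordCells hq0 hq1 H huK hsK
  simp only
  linarith [key]

end ThreeApex

end FK

end Summit.CriticalPhenomena.PercolationContinuityZ3.Theorems
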